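import Summits.MatrixMultiplication.MatrixMultiplication.Theorems.SoloBlindAbelianRealization
import Literature.Computability.AlgebraicComplexity.BorderRankRestriction
import Literature.Computability.AlgebraicComplexity.AlderStrassen
import HarnessLib

/-!
# Monomial degenerations of abelian realizations bound the border rank of powers of `T_{cw,2}`

Second rung for the asymptotic-rank line to `ω(ℂ) = 2` (solo-blind).  The first rung
(`SoloBlindAbelianRealization`: an abelian realization of `supp T_xyz^{⊠N}` in `H` gives
`R(T_{cw,2}^{⊠N}) ≤ |H|`) is relaxed from RANK to BORDER RANK by allowing a toric (monomial)
degeneration: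

* `algBorderRank_initialPart_le_tensorRank` — **monomial degeneration** (Bürgisser–Clausen–Shokrollahi
  1997, §15.5; Strassen 1987): for weights `w₁ w₂ w₃ : _ → ℕ` and an order `h` such that `t` vanishes
  where `w₁ a + w₂ b + w₃ c < h`, the weight-`h` part of `t` has border rank `≤ R(t)` (scale the
  factors of an exact decomposition by `ε^{wᵢ}`).
* `algBorderRank_kroneckerPow_cwTensor_le_card_of_degeneration` — **the rung**: maps
  `s : (Fin N → Fin 3) → H`, `u : H`, weights `ω : (Fin N → Fin 3) → ℕ`, `h : ℕ` with
  (i) every support triple of `T_xyz^{⊠N}` (coordinatewise pairwise distinct) satisfies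
  `s a + s b + s c = u` and `ω a + ω b + ω c = h`, and (ii) every other solution of
  `s a + s b + s c = u` has `ω a + ω b + ω c > h`, give `bR(T_{cw,2}^{⊠N}) ≤ |H|`
  (so `R̃(T_{cw,2}) ≤ |H|^{1/N}`, since `R̃ ≤ bR` of powers).

With `|H| = 4^N` such data exist for every `N` (products of the `ℤ/4` degeneration `0 ↦ 0, 1 ↦ 1,
2 ↦ 2`, `u = 3`, `ω = (0,3,0)`, `h = 3`, recovering `bR(T_{cw,2}) ≤ 4 = 2 + 2`); whether some `N`
admits `|H| < 4^N` — which would prove `R̃(T_{cw,2}) < 4` — is the open question this rung serves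
(exhaustively `|H| ≥ 16 = bR(T_{cw,2}^{⊠2})` for `N = 2`; `N = 3` under search, solo-blind s1).

## References
* P. Bürgisser, M. Clausen, M. A. Shokrollahi, *Algebraic Complexity Theory*, Springer 1997, §15.5
  (degeneration order / monomial degenerations).
* J. Alman, V. Vassilevska Williams, *Limits on all known (and some unknown) approaches to matrix
  multiplication*, FOCS 2018, arXiv:1810.08671, §6 (CW tensors as sub-tensors / monomial
  degenerations of group tensors `T_G`).
-/

noncomputable section

open scoped BigOperators Polynomial

open Literature.Computability.AlgebraicComplexity

set_option linter.dupNamespace false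

namespace Summit.MatrixMultiplication.MatrixMultiplication.Theorems

set_option quotPrecheck false in
local notation "xyzT" =>
  (fun a b c : Fin 3 => if a ≠ b ∧ b ≠ c ∧ a ≠ c then (1 : ℂ) else 0)

/-- **Monomial degeneration bound.** If `t` vanishes below total weight `h`, its weight-`h` part
has border rank at most `R(t)`: scaling the factors of an exact decomposition by `ε^{w₁ a}`,
`ε^{w₂ b}`, `ε^{w₃ c}` gives an approximate decomposition of order `h`.
[cite: BurgisserClausenShokrollahi1997, §15.5] -/
theorem algBorderRank_initialPart_le_tensorRank {ι κ μ : Type} [Fintype ι] [Fintype κ]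
    [Fintype μ] [DecidableEq ι] [DecidableEq κ] [DecidableEq μ] {K : Type*} [CommRing K] (t : ι → κ → μ → K) (w₁ : ι → ℕ) (w₂ : κ → ℕ)
    (w₃ : μ → ℕ) (h : ℕ) (hlow : ∀ a b c, w₁ a + w₂ b + w₃ c < h → t a b c = 0) :
    algBorderRank (fun a b c => if w₁ a + w₂ b + w₃ c = h then t a b c else 0) ≤ tensorRank t := by
  obtain ⟨x, y, z, hxyz⟩ := exists_eq_sum_triad_of_tensorRank_le (le_refl (tensorRank t))
  refine (algBorderRank_le_approxRank h _).trans
    (approxRank_le_of_isApproxDecomposition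
      (u := fun i a => Polynomial.C (x i a) * Polynomial.X ^ (w₁ a))
      (v := fun i b => Polynomial.C (y i b) * Polynomial.X ^ (w₂ b))
      (w := fun i c => Polynomial.C (z i c) * Polynomial.X ^ (w₃ c)) ?_)
  intro a b c j hj
  have ht : t a b c = ∑ ρ, x ρ a * y ρ b * z ρ c := by
    have := congrFun (congrFun (congrFun hxyz a) b) c
    simpa [Finset.sum_apply, triad_apply] using this
  have hsum : (∑ ρ, Polynomial.C (x ρ a) * Polynomial.X ^ (w₁ a) *
      (Polynomial.C (y ρ b) * Polynomial.X ^ (w₂ b)) *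
        (Polynomial.C (z ρ c) * Polynomial.X ^ (w₃ c))) =
      Polynomial.C (t a b c) * Polynomial.X ^ (w₁ a + w₂ b + w₃ c) := by
    rw [ht, map_sum, Finset.sum_mul]
    refine Finset.sum_congr rfl fun ρ _ => ?_
    simp only [map_mul, pow_add]
    ring
  rw [hsum, Polynomial.coeff_C_mul_X_pow]
  dsimp only
  split_ifs <;> first | rfl | exact hlow a b c (by omega) | (exfalso; omega)

/-- **The degeneration rung.** A monomial degeneration of an abelian realization: if every support
triple of `T_xyz^{⊠N}` solves `s a + s b + s c = u` with total weight exactly `h`, and every other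
solution has total weight `> h`, then `bR(T_{cw,2}^{⊠N}) ≤ |H|`. [new] -/
theorem algBorderRank_kroneckerPow_cwTensor_le_card_of_degeneration {N : ℕ} {H : Type*}
    [AddCommGroup H] [Fintype H] [DecidableEq H] (s : (Fin N → Fin 3) → H) (u : H)
    (ω : (Fin N → Fin 3) → ℕ) (h : ℕ)
    (hsupp : ∀ a b c : Fin N → Fin 3, (∀ i, a i ≠ b i ∧ b i ≠ c i ∧ a i ≠ c i) →
      s a + s b + s c = u ∧ ω a + ω b + ω c = h)
    (hcut : ∀ a b c : Fin N → Fin 3, s a + s b + s c = u →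
      ¬ (∀ i, a i ≠ b i ∧ b i ≠ c i ∧ a i ≠ c i) → h < ω a + ω b + ω c) :
    algBorderRank (kroneckerPow (cwTensor ℂ 2) N) ≤ Fintype.card H := by
  have h1 : algBorderRank (kroneckerPow (cwTensor ℂ 2) N) ≤ algBorderRank (kroneckerPow xyzT N) :=
    ((xyzTensor_restrictsTo_cwTensor).kroneckerPow N).algBorderRank_le
  have h2 : kroneckerPow xyzT N = fun a b c => if ω a + ω b + ω c = h then
      (if s a + s b + s c = u then (1 : ℂ) else 0) else 0 := by
    funext a b c
    rw [kroneckerPow_apply]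
    by_cases hall : ∀ i, a i ≠ b i ∧ b i ≠ c i ∧ a i ≠ c i
    · obtain ⟨hs, hw⟩ := hsupp a b c hall
      rw [if_pos hw, if_pos hs]
      exact Finset.prod_eq_one fun i _ => by simp [hall i]
    · have lhs0 : (∏ i, xyzT (a i) (b i) (c i)) = 0 := by
        obtain ⟨i, hi⟩ := not_forall.mp hall
        exact Finset.prod_eq_zero (Finset.mem_univ i) (if_neg hi)
      rw [lhs0]
      by_cases hs : s a + s b + s c = u
      · have := hcut a b c hs hall
        rw [if_neg (by omega)]
      · rw [if_neg hs]
        simp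
  rw [h2] at h1
  refine h1.trans ((algBorderRank_initialPart_le_tensorRank
    (fun a b c : Fin N → Fin 3 => if s a + s b + s c = u then (1 : ℂ) else 0) ω ω ω h ?_).trans
    (tensorRank_indicator₃_le_card s s s u))
  intro a b c hlt
  by_cases hs : s a + s b + s c = u
  · exfalso
    by_cases hall : ∀ i, a i ≠ b i ∧ b i ≠ c i ∧ a i ≠ c i
    · have := (hsupp a b c hall).2
      omega
    · have := hcut a b c hs hall
      omega
  · exact if_neg hs

/-- Consequence for the tree's inline form of `T_{cw,2}^{⊠N}`. [new] -/
theorem algBorderRank_cwTwoPow_le_card_of_degeneration {N : ℕ} {H : Type*}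
    [AddCommGroup H] [Fintype H] [DecidableEq H] (s : (Fin N → Fin 3) → H) (u : H)
    (ω : (Fin N → Fin 3) → ℕ) (h : ℕ)
    (hsupp : ∀ a b c : Fin N → Fin 3, (∀ i, a i ≠ b i ∧ b i ≠ c i ∧ a i ≠ c i) →
      s a + s b + s c = u ∧ ω a + ω b + ω c = h)
    (hcut : ∀ a b c : Fin N → Fin 3, s a + s b + s c = u →
      ¬ (∀ i, a i ≠ b i ∧ b i ≠ c i ∧ a i ≠ c i) → h < ω a + ω b + ω c) :
    algBorderRank (K := ℂ) (fun a b c : Fin N → Fin 3 => ∏ i,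
        (if (a i = 0 ∧ b i = c i ∧ b i ≠ 0) ∨ (b i = 0 ∧ a i = c i ∧ a i ≠ 0) ∨
          (c i = 0 ∧ a i = b i ∧ a i ≠ 0) then (1 : ℂ) else 0)) ≤ Fintype.card H := by
  rw [cwTwoPow_inline_eq]
  exact algBorderRank_kroneckerPow_cwTensor_le_card_of_degeneration s u ω h hsupp hcut

/-! ## Non-vacuity: the product degeneration in `(ℤ/4)^N` -/

/- One coordinate: `0 ↦ 0, 1 ↦ 1, 2 ↦ 2` in `ℤ/4` (target `3`) with weights `(0, 3, 0)`: the
solutions of `x + y + z = 3` are the six permutations (weight `3`) and `(1,1,1)` (weight `9`). -/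
local notation "e4" => (![(0 : ZMod 4), 1, 2] : Fin 3 → ZMod 4)
local notation "wt4" => (![(0 : ℕ), 3, 0] : Fin 3 → ℕ)

/-- Permutations solve `x + y + z = 3` in `ℤ/4` with weight exactly `3`. [new] -/
theorem e4_sum_of_distinct (x y z : Fin 3) (hd : x ≠ y ∧ y ≠ z ∧ x ≠ z) :
    e4 x + e4 y + e4 z = 3 ∧ wt4 x + wt4 y + wt4 z = 3 := by
  revert x y z
  decide

/-- Every solution of `x + y + z = 3` in `ℤ/4` has weight `≥ 3`, and `> 3` unless it is a
permutation. [new] -/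
theorem wt4_of_e4_sum (x y z : Fin 3) (hs : e4 x + e4 y + e4 z = 3) :
    3 ≤ wt4 x + wt4 y + wt4 z ∧ (¬ (x ≠ y ∧ y ≠ z ∧ x ≠ z) → 3 < wt4 x + wt4 y + wt4 z) := by
  revert x y z
  decide

/-- **The product degeneration** in `(ℤ/4)^N` satisfies the hypotheses of the rung (with
`h = 3N`), recovering `bR(T_{cw,2}^{⊠N}) ≤ 4^N`. [new] -/
theorem algBorderRank_kroneckerPow_cwTensor_two_le_four_pow (N : ℕ) :
    algBorderRank (kroneckerPow (cwTensor ℂ 2) N) ≤ 4 ^ N := by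
  have hcard : Fintype.card (Fin N → ZMod 4) = 4 ^ N := by simp
  rw [← hcard]
  refine algBorderRank_kroneckerPow_cwTensor_le_card_of_degeneration
    (fun x i => e4 (x i)) (fun _ => 3) (fun x => ∑ i, wt4 (x i)) (3 * N) ?_ ?_
  · intro a b c hall
    refine ⟨funext fun i => ?_, ?_⟩
    · simp only [Pi.add_apply]
      exact (e4_sum_of_distinct _ _ _ (hall i)).1
    · rw [← Finset.sum_add_distrib, ← Finset.sum_add_distrib]
      rw [Finset.sum_congr rfl fun i _ => (e4_sum_of_distinct _ _ _ (hall i)).2]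
      simp [mul_comm]
  · intro a b c hs hall
    have hs' : ∀ i, e4 (a i) + e4 (b i) + e4 (c i) = 3 := fun i => by
      have := congrFun hs i
      simpa using this
    obtain ⟨i₀, hi₀⟩ := not_forall.mp hall
    rw [← Finset.sum_add_distrib, ← Finset.sum_add_distrib]
    calc 3 * N = ∑ _i : Fin N, 3 := by simp [mul_comm]
      _ < ∑ i, (wt4 (a i) + wt4 (b i) + wt4 (c i)) :=
        Finset.sum_lt_sum (fun i _ => (wt4_of_e4_sum _ _ _ (hs' i)).1)
          ⟨i₀, Finset.mem_univ _, (wt4_of_e4_sum _ _ _ (hs' i₀)).2 hi₀⟩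

end Summit.MatrixMultiplication.MatrixMultiplication.Theorems
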